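import Literature.NumberTheory.LFunctions.NoRealZeroEvenSmallModuli
import Literature.NumberTheory.LFunctions.NoRealZeroEvenSmallModuliII
import Literature.NumberTheory.LFunctions.NoRealZeroEvenSmallModuliIII
import Literature.NumberTheory.LFunctions.NoRealZeroEvenSmallModuliIV
import Literature.NumberTheory.LFunctions.NoRealZeroEvenSmallModuliV
import Literature.NumberTheory.LFunctions.NoRealZeroEvenModulus293
import Literature.NumberTheory.LFunctions.NoRealZeroSmallModuliIII
import HarnessLib

/-!
# The kernel base of the EVEN no-real-zero column: `NoRealZeroEvenUpTo 436`, unconditionally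

Topic `Literature/NumberTheory/LFunctions`; namespace `Literature.NumberTheory.LFunctions`. THEOREMS only
(no definition, no named fact, no `sorry`): the assembly of `noRealZeroEvenUpTo_292`
(`NoRealZeroEvenSmallModuli.lean`: Fekete–Pólya of order `≤ 2` along small induced moduli), the modulus
`293` (`good293`, `NoRealZeroEvenModulus293.lean`: order `8` along the induced modulus `293·1001`, six
kernel segments) and the range lemmas `noRealZeroEven_range_294_329` / `_330_365` / `_366_401` / `_402_436`
(`NoRealZeroEvenSmallModuliII–V.lean`: orders `k ≤ 12`, induced moduli `≤ 9 086`):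

* **`noRealZeroEvenUpTo_436 : NoRealZeroEvenUpTo 436`** — for every modulus `3 ≤ q ≤ 436`, every
  primitive quadratic EVEN `χ` mod `q` (real quadratic fields of discriminant `≤ 436`) and every
  `σ ∈ (0, 1)`, `L(σ, χ) ≠ 0`. `437 = 19·23` is the next wall: `χ₄₃₇` has no Fekete–Pólya witness of
  order `≤ 24` and induced modulus `≤ 3·10⁶` (kit j260692).
* `noRealZero_kernelBase_231_436 : NoRealZeroUpTo 231 ∧ NoRealZeroEvenUpTo 436`.

WHAT THIS IS NOT: nothing for odd characters beyond `231` (`χ_{−232}`, `χ_{−267}` have no witness within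
the same bounds; `χ_{−235}` does — `m = 235·231`, `k = 9` — but does not extend the contiguous range);
no claim about complex zeros; the cell's certified numerics (`10⁹`/`10¹⁰`) and Platt's printed `4·10⁵`
are the ranges of record, this only raises what the KERNEL proves outright.

## References

* H. L. Montgomery, R. C. Vaughan, *Multiplicative Number Theory I*, CUP 2007, §9.3, Thm 9.13,
  §11.2.1 Exercises 7–8. [MontgomeryVaughan2007]
* S. Chowla, *Note on Dirichlet's `L`-functions*, Acta Arith. 1 (1935) 113–114. [Chowla1935]
* J. B. Rosser, *Real roots of real Dirichlet L-series*, J. Research Nat. Bur. Standards 45 (1950)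
  505–514. [Rosser1950RealRoots]
-/

namespace Literature.NumberTheory.LFunctions

/-- **`NoRealZeroEvenUpTo 436`, unconditionally** (kernel base of the even half of the wide column).
[cite: MontgomeryVaughan2007, §11.2.1 Exercises 7–8] [cite: Chowla1935] -/
theorem noRealZeroEvenUpTo_436 : NoRealZeroEvenUpTo 436 := by
  intro q _ hq3 hqN χ hquad hprim hev σ hσ0 hσ1
  by_cases h292 : q ≤ 292
  · exact noRealZeroEvenUpTo_292 q hq3 h292 χ hquad hprim hev σ hσ0 hσ1
  by_cases h293 : q ≤ 293
  · obtain rfl : q = 293 := by omega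
    exact good293 χ hquad hprim σ hσ0 hσ1
  by_cases h329 : q ≤ 329
  · exact noRealZeroEven_range_294_329 q (by omega) h329 χ hquad hprim hev σ hσ0 hσ1
  by_cases h365 : q ≤ 365
  · exact noRealZeroEven_range_330_365 q (by omega) h365 χ hquad hprim hev σ hσ0 hσ1
  by_cases h401 : q ≤ 401
  · exact noRealZeroEven_range_366_401 q (by omega) h401 χ hquad hprim hev σ hσ0 hσ1
  exact noRealZeroEven_range_402_436 q (by omega) hqN χ hquad hprim hev σ hσ0 hσ1

/-- The kernel bases of the wide column after this file: both parities to `231`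
(`noRealZeroUpTo_231`), even to `436`. [cite: Rosser1950RealRoots] -/
theorem noRealZero_kernelBase_231_436 : NoRealZeroUpTo 231 ∧ NoRealZeroEvenUpTo 436 :=
  ⟨noRealZeroUpTo_231, noRealZeroEvenUpTo_436⟩

end Literature.NumberTheory.LFunctions
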